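import Literature.MathematicalPhysics.QuantumFieldTheory.Balaban1983to89.B7Prop7BackgroundModulusLevels
import Literature.MathematicalPhysics.QuantumFieldTheory.Balaban1983to89.B11Eq44CLetterTower

/-!
# `Balaban1983to89.B11Eq44COperatorTowerTwoBackgrounds` — T. Bałaban, *The variational problem and background fields in renormalization group method for lattice gauge
# theories*, Commun. Math. Phys. **102** (1985) 277–309 [Balaban1985Variational] Sect. C (44), (47)–(52) p. 285 with [Balaban1985Averaging] Proposition 7 p. 43, Proposition 4
# (130)–(135) p. 38: **THE SECT. C LETTER `C_k` OF (44) AT `k` AVERAGING LEVELS IS LIPSCHITZ IN THE BACKGROUND AT THE FLAT POINT, WITH A CONSTANT FREE OF THE NUMBER OF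
# LEVELS** — `‖C_k(U)Y − C_k(1)(ιY)‖_(−0) ≤ (24∕(Lᵏρ′))·(Lᵏε)·‖Y‖_(115)` for `‖U(b) − 1‖ ≤ ε` (`6ε ≤ ρ′`) on `2‖Y‖ ≤ Lᵏρ` — the `k`-level (`towerP`) twin of ne9-leaf-04's
# `B11Eq44COperatorTwoBackgrounds` (ONE step, `fineP`), i.e. the displayed modulus `δ_C` of this lineage's Support face `NE9CurChartTowerPiLipschitzAtFlatLatticeUniform` PRODUCED in
# lattice-free form (on the diagonal `ηL^{n+1} = 1`, `k = n+1`: `Lᵏε = α`, the radii `Lᵏρ′`, `Lᵏρ` are Prop. 7's polydisc radii in coarse units).  Inputs BY NAME: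
# `B7Prop7BackgroundModulusLevels.{norm_logCovIter_sub_flat_le, norm_linCovIter_sub_flat_le}` (Cauchy estimates on Prop. 7), `B11Eq44COperatorTower.{Cblockk_apply,
# norm_perCfg_smul_le}`, `B11Eq44CLetterTower.{equiv_Cck_apply, eta_mul_norm_le_of_weight_k}`.  NE9 crux-team LEAF PROVER 01 (`b2b-balaban-t4-ne9-formalise-leaf-01`), gen 104;
# cell `pub-balaban`∕`t4`, row NE9, bears_on R4/N22.
# WHAT IS PROVED (sorry-free; 0 `def`): **`norm_Cblockk_sub_flat_le`** (at a unit bond), **`norm_Cck_sub_Cck_le`** (at the carrier, any two derivative letters, same underlying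
# configuration), `norm_Cck_sub_Cck_jetId_le`, **`sectC_modulus_tower`** (the `δ_C`-slot VERBATIM).  HONEST SCOPE: [folklore] composition; crude constants; Prop. 7's regime DISPLAYED
# as the five smallness inequalities; print has no two-background `C`-modulus (it is the cell's reading of Prop. 7's analyticity in the background); «NE9 ⇐ the named binders»;
# NE9 NOT PRINTED ∕ NOT PROVED; spine PROVED 0∕9; rung (B)+1 finite T⁴ — NOT infinite volume, NOT mass gap, NOT BetaPertH, NOT Clay.  HONEST DEPENDENCY: continuum YM on T⁴ ⇐
# BetaPertH ∧ nine spine estimates (0/9 proved); BetaPertH ⇐ (D1) ∧ (D4) ∧ CAP+tail; G-an2-4 gates asym, D1 and NE2/3/4.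

statement-level skeleton of published theorems with citation tags; proofs where landed; nothing here is a claim about the Yang–Mills mass gap
-/

noncomputable section

namespace Literature.MathematicalPhysics.QuantumFieldTheory.Balaban1983to89.B11Eq44COperatorTowerTwoBackgrounds

open B11Eq115Space B11Eq111FrakG
open B9SectCLatticeCarrier (Bond)
open B4Sect5Torus (TSite)
open B7Prop2Explicit (AvgClosed C0 c2')
open B7Prop3Flat (c3)
open B9Eq315QTorus (perCfg perCfg_apply)
open B9Eq315QTower (towerP)
open B9Eq315QTorusOnto (liftSite)
open B11Eq44COperatorTower (Cblockk Cblockk_apply norm_perCfg_smul_le)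
open B11Eq44CLetterTower (Cck equiv_Cck_apply eta_mul_norm_le_of_weight_k)
open B7Prop7BackgroundModulusLevels (norm_logCovIter_sub_flat_le norm_linCovIter_sub_flat_le)

variable {d : ℕ} {𝔸 : Type*} [NormedRing 𝔸] [NormedAlgebra ℂ 𝔸] [CompleteSpace 𝔸] [NormOneClass 𝔸]
  (L : ℕ) [NeZero L] (m : Fin d → ℕ) [∀ i, NeZero (m i)] (η : ℝ) (k : ℕ) (U : Bond d (towerP L m k) → 𝔸ˣ)
  (hL : 2 ≤ L) {G : Subgroup 𝔸ˣ} (hG : AvgClosed d L G) {α₀ : ℝ} (hα : 0 < α₀) (hα3 : C0 d * α₀ ≤ 1 / 3) (hα8 : 8 * α₀ ≤ c2' d L)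
  {ρ' ρ : ℝ} (hρ' : 0 < ρ') (hρ : 0 < ρ)
  (hsmall' : Real.exp (4 * (800 * ((d : ℝ) + 1) ^ 2 * ((d : ℝ) + 4)) * α₀)
    * (1 + 8 * (131072 * ((d : ℝ) + 1) ^ 2) * ((L : ℝ) ^ k * ρ')) ≤ 2)
  (hc₃' : 2 * ((L : ℝ) ^ k * ρ') ≤ c3 d L) (hρ'1 : 409600 * ((d : ℝ) + 1) ^ 2 * ((L : ℝ) ^ k * ρ') ≤ 1)
  (hsmall : Real.exp (4480 * ((d : ℝ) + 1) ^ 2 * ((d : ℝ) + 4) * α₀ + 240000 * ((d : ℝ) + 1) ^ 3 * ((L : ℝ) ^ k * ρ'))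
    * (1 + 8 * (2097152 * ((d : ℝ) + 1) ^ 2) * ((L : ℝ) ^ k * ρ)) ≤ 2)
  (hc₃ : 2 * ((L : ℝ) ^ k * ρ) ≤ c3 d L / 4)
  {ε : ℝ} (hε : 0 ≤ ε) (hUε : ∀ b : Bond d (towerP L m k), ‖((U b : 𝔸ˣ) : 𝔸) - 1‖ ≤ ε) (hερ : 6 * ε ≤ ρ')

/-! ## §1 At a unit bond: `Cblockk U A − Cblockk 1 A` -/

include hL hG hα hα3 hα8 hρ' hρ hsmall' hc₃' hρ'1 hsmall hc₃ hε hUε hερ in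
/-- **THE `k`-LEVEL BLOCK MAP `C_k(Lᵏη·)` IS LIPSCHITZ IN THE BACKGROUND AT THE FLAT POINT** at every unit bond: for `η·sup‖A‖ ≤ a` with `2a ≤ ρ` (fine units) and a background
`‖U(b) − 1‖ ≤ ε`, `6ε ≤ ρ′`: `‖Cblockk U A c − Cblockk 1 A c‖ ≤ 2·(12∕(Lᵏρ′))·(Lᵏε)·(Lᵏa)` — `Cblockk = logCovIter − linCovIter` of the periodic extensions (`Cblockk_apply`),
each half by `B7Prop7BackgroundModulusLevels`. [cite: Balaban1985Variational, (44) p.285, (52) p.285; Balaban1985Averaging, (134) p.38, Proposition 7 p.43] -/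
theorem norm_Cblockk_sub_flat_le (hη : 0 ≤ η) (A : Bond d (towerP L m k) → 𝔸) {a : ℝ} (ha : 0 ≤ a) (hA : ∀ b, η * ‖A b‖ ≤ a) (haρ : 2 * a ≤ ρ)
    (c : Bond d m) :
    ‖Cblockk L m η k U A c - Cblockk L m η k (fun _ : Bond d (towerP L m k) => (1 : 𝔸ˣ)) A c‖ ≤
      2 * (12 / ((L : ℝ) ^ k * ρ') * ((L : ℝ) ^ k * ε) * ((L : ℝ) ^ k * a)) := by
  have hAp : ∀ (x : B7Prop1Explicit.Site d) (κ : Fin d), ‖perCfg (towerP L m k) ((η : ℂ) • A) x κ‖ ≤ a := norm_perCfg_smul_le L m η k hη A hA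
  have hUp : ∀ (x : B7Prop1Explicit.Site d) (κ : Fin d), ‖((perCfg (towerP L m k) U x κ : 𝔸ˣ) : 𝔸) - 1‖ ≤ ε := fun x κ => by rw [perCfg_apply]; exact hUε _
  have h1 : perCfg (towerP L m k) (fun _ : Bond d (towerP L m k) => (1 : 𝔸ˣ)) = 1 := rfl
  have hQ := norm_logCovIter_sub_flat_le L hL hG k hα hα3 hα8 hρ' hsmall' hc₃' hρ'1 hsmall hc₃ (perCfg (towerP L m k) U) hε hUp hερ
    (perCfg (towerP L m k) ((η : ℂ) • A)) ha hAp (by linarith) (liftSite c.1) c.2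
  have hLin := norm_linCovIter_sub_flat_le L hL hG k hα hα3 hα8 hρ' hρ hsmall' hc₃' hρ'1 hsmall hc₃ (perCfg (towerP L m k) U) hε hUp hερ
    (perCfg (towerP L m k) ((η : ℂ) • A)) ha hAp haρ (liftSite c.1) c.2
  rw [Cblockk_apply, Cblockk_apply, h1, sub_sub_sub_comm]
  exact (norm_sub_le _ _).trans (by linarith)

/-! ## §2 At the carrier: `Cck U Y − Cck 1 Y′` for two (115) spaces with the same underlying configuration -/

variable {κ' : Type*} [Fintype κ'] (lev₀ : Bond d (towerP L m k) → ℕ) (lev₁ : κ' → ℕ)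
  (Dc Dc' : (Bond d (towerP L m k) → 𝔸) →ₗ[ℂ] (κ' → 𝔸)) (levB : Bond d m → ℕ) [Fact (0 < η)] [Fact (0 < (L : ℝ))] (hlev : ∀ b, k ≤ lev₀ b)

include hL hG hα hα3 hα8 hρ' hρ hsmall' hc₃' hρ'1 hsmall hc₃ hε hUε hερ hlev in
/-- **THE LETTER `C_k` IS LIPSCHITZ IN THE BACKGROUND AT THE CARRIER, LATTICE-FREE**: for `Y ∈ Space115 … ∇`, `Y′ ∈ Space115 … ∇′` with the same underlying configuration,
`k ≤ lev₀` and `2‖Y‖_(115) ≤ Lᵏρ` (so `η·sup‖Y‖ ≤ ‖Y‖∕Lᵏ`, `B11Eq44CLetterTower.eta_mul_norm_le_of_weight_k`):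
`‖Cck U … Y − Cck 1 … Y′‖_(−0) ≤ (24∕(Lᵏρ′))·(Lᵏε)·‖Y‖` (§1 pointwise in the weight-`1` norm `|·|_(−0)`).
[cite: Balaban1985Variational, (44) p.285, (51)–(52) p.285; Balaban1985Averaging, Proposition 7 p.43] -/
theorem norm_Cck_sub_Cck_le {Y : Space115 (L : ℝ) η lev₀ lev₁ Dc} {Y' : Space115 (L : ℝ) η lev₀ lev₁ Dc'}
    (hYY' : JetSup.equiv _ _ Dc' Y' = JetSup.equiv _ _ Dc Y) (hY : 2 * ‖Y‖ ≤ (L : ℝ) ^ k * ρ) :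
    ‖Cck L m η k U lev₀ lev₁ Dc levB Y - Cck L m η k (fun _ : Bond d (towerP L m k) => (1 : 𝔸ˣ)) lev₀ lev₁ Dc' levB Y'‖ ≤
      24 / ((L : ℝ) ^ k * ρ') * ((L : ℝ) ^ k * ε) * ‖Y‖ := by
  have hL1 : (1 : ℝ) ≤ L := by exact_mod_cast le_trans (by norm_num) hL
  have hLk : (0 : ℝ) < (L : ℝ) ^ k := pow_pos (lt_of_lt_of_le one_pos hL1) k
  have hηnn : 0 ≤ η := (Fact.out : 0 < η).le
  have ha : ∀ b, η * ‖JetSup.equiv _ _ Dc Y b‖ ≤ ‖Y‖ / (L : ℝ) ^ k :=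
    eta_mul_norm_le_of_weight_k L m η k lev₀ hlev hL1 hηnn (JetSup.equiv _ _ Dc Y) (JetSup.weight_mul_norm_apply_le Y)
  have haρ : 2 * (‖Y‖ / (L : ℝ) ^ k) ≤ ρ := by
    rw [mul_div_assoc', div_le_iff₀ hLk]; linarith
  -- (`positivity` on a goal carrying the (115) norm `‖Y‖` is a `whnf` blowup: split the sign by hand)
  have hK0 : (0 : ℝ) ≤ 24 / ((L : ℝ) ^ k * ρ') * ((L : ℝ) ^ k * ε) := by positivity
  have hK : 0 ≤ 24 / ((L : ℝ) ^ k * ρ') * ((L : ℝ) ^ k * ε) * ‖Y‖ := mul_nonneg hK0 (norm_nonneg Y)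
  refine (NegSup.norm_le_iff (w := levWeight (L : ℝ) η levB 0) (V := 𝔸) hK).2 fun c => ?_
  have e : NegSup.equiv (levWeight (L : ℝ) η levB 0) 𝔸 (Cck L m η k U lev₀ lev₁ Dc levB Y -
        Cck L m η k (fun _ : Bond d (towerP L m k) => (1 : 𝔸ˣ)) lev₀ lev₁ Dc' levB Y') c =
      Cblockk L m η k U (JetSup.equiv _ _ Dc Y) c - Cblockk L m η k (fun _ : Bond d (towerP L m k) => (1 : 𝔸ˣ)) (JetSup.equiv _ _ Dc Y) c := by
    rw [NegSup.equiv_sub, Pi.sub_apply, equiv_Cck_apply, equiv_Cck_apply, hYY']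
  have hw : levWeight (L : ℝ) η levB 0 c = 1 := by rw [levWeight_apply, pow_zero]
  rw [e, hw, one_mul]
  have h := norm_Cblockk_sub_flat_le L m η k U hL hG hα hα3 hα8 hρ' hρ hsmall' hc₃' hρ'1 hsmall hc₃ hε hUε hερ hηnn (JetSup.equiv _ _ Dc Y)
    (div_nonneg (norm_nonneg Y) hLk.le) ha haρ c
  refine h.trans (le_of_eq ?_)
  rw [mul_div_cancel₀ _ hLk.ne']
  ring

include hL hG hα hα3 hα8 hρ' hρ hsmall' hc₃' hρ'1 hsmall hc₃ hε hUε hερ hlev in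
/-- **… IN PARTICULAR ACROSS THE JET IDENTITY `ι_{∇_U→∇_1}`** (which does not change the configuration):
`‖Cck U …(∇_U)… P − Cck 1 …(∇_1)… (ιP)‖ ≤ (24∕(Lᵏρ′))·(Lᵏε)·‖P‖` on `2‖P‖ ≤ Lᵏρ`. [cite: Balaban1985Variational, (44) p.285, (115) p.294, (117) p.295] -/
theorem norm_Cck_sub_Cck_jetId_le [FiniteDimensional ℂ 𝔸] (lev₁ : Bond d (towerP L m k) × Fin d → ℕ) (P : Space115 (L : ℝ) η lev₀ lev₁ (nabla115 η U))
    (hP : 2 * ‖P‖ ≤ (L : ℝ) ^ k * ρ) :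
    ‖Cck L m η k U lev₀ lev₁ (nabla115 η U) levB P -
        Cck L m η k (fun _ : Bond d (towerP L m k) => (1 : 𝔸ˣ)) lev₀ lev₁ (nabla115 η (fun _ : Bond d (towerP L m k) => (1 : 𝔸ˣ))) levB
          (LinearMap.toContinuousLinearMap
            ((jetLinearEquiv (L : ℝ) η lev₀ lev₁ (nabla115 η (fun _ : Bond d (towerP L m k) => (1 : 𝔸ˣ)))).symm.toLinearMap ∘ₗ
              (jetLinearEquiv (L : ℝ) η lev₀ lev₁ (nabla115 η U)).toLinearMap) P)‖ ≤
      24 / ((L : ℝ) ^ k * ρ') * ((L : ℝ) ^ k * ε) * ‖P‖ :=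
  norm_Cck_sub_Cck_le L m η k U hL hG hα hα3 hα8 hρ' hρ hsmall' hc₃' hρ'1 hsmall hc₃ hε hUε hερ lev₀ lev₁ (nabla115 η U)
    (nabla115 η (fun _ : Bond d (towerP L m k) => (1 : 𝔸ˣ))) levB hlev rfl hP

include hL hG hα hα3 hα8 hρ' hρ hsmall' hc₃' hρ'1 hsmall hc₃ hε hUε hερ hlev in
/-- **THE `δ_C`-SLOT OF THE LATTICE-UNIFORM TWO-BACKGROUND FACE, PRODUCED**: if the Sect. C radii satisfy `2(ε_C + a_C) ≤ Lᵏρ` then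
`∀ P, ‖P‖ < ε_C + a_C → ‖C_k(U)P − C_k(1)(ιP)‖ ≤ (24∕(Lᵏρ′))·(Lᵏε)·(ε_C + a_C)` — linear in the background's distance `ε` (`= αη` in print's window), NO dependence on
the height, the spacing or the period beyond `Lᵏε`, `Lᵏρ′`, `Lᵏρ`. [cite: Balaban1985Variational, (44) p.285, (51)–(52) p.285, (174) p.305; Balaban1985Averaging, Proposition 7 p.43] -/
theorem sectC_modulus_tower [FiniteDimensional ℂ 𝔸] (lev₁ : Bond d (towerP L m k) × Fin d → ℕ) {εC aC : ℝ} (hcap : 2 * (εC + aC) ≤ (L : ℝ) ^ k * ρ) :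
    ∀ P : Space115 (L : ℝ) η lev₀ lev₁ (nabla115 η U), ‖P‖ < εC + aC →
      ‖Cck L m η k U lev₀ lev₁ (nabla115 η U) levB P -
          Cck L m η k (fun _ : Bond d (towerP L m k) => (1 : 𝔸ˣ)) lev₀ lev₁ (nabla115 η (fun _ : Bond d (towerP L m k) => (1 : 𝔸ˣ))) levB
            (LinearMap.toContinuousLinearMap
              ((jetLinearEquiv (L : ℝ) η lev₀ lev₁ (nabla115 η (fun _ : Bond d (towerP L m k) => (1 : 𝔸ˣ)))).symm.toLinearMap ∘ₗ
                (jetLinearEquiv (L : ℝ) η lev₀ lev₁ (nabla115 η U)).toLinearMap) P)‖ ≤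
        24 / ((L : ℝ) ^ k * ρ') * ((L : ℝ) ^ k * ε) * (εC + aC) := fun P hP =>
  (norm_Cck_sub_Cck_jetId_le L m η k U hL hG hα hα3 hα8 hρ' hρ hsmall' hc₃' hρ'1 hsmall hc₃ hε hUε hερ lev₀ levB hlev lev₁ P (by linarith [hP.le])).trans
    (mul_le_mul_of_nonneg_left hP.le (by positivity))

end Literature.MathematicalPhysics.QuantumFieldTheory.Balaban1983to89.B11Eq44COperatorTowerTwoBackgrounds

end
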